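/-
Fleet lead `ym-wcr-19609-p1` (seat prover-ym-wcr-19609-p1-g2-0), route `WeakCouplingRates`, crux `BulkDominatesColdBoxW`
(stmt-QuantumFields-19609), line `dlr-chessboard` (skeleton v8 `467507eaefe7a2cc`): the registered stub `stub_kernelCovExpansion` — PROVED.
-/
import Summits.QuantumFields.YangMills.Theorems.WeakCouplingRatesBulkDominatesColdBoxWKernelCovDatumRpow
import Summits.QuantumFields.YangMills.Theorems.WeakCouplingRatesBulkDominatesColdBoxWKernelBridge
import Summits.QuantumFields.YangMills.Theorems.WeakCouplingRatesBulkDominatesColdBoxWNearCentreEdges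
import Summits.QuantumFields.YangMills.Theorems.WeakCouplingRatesBulkDominatesColdBoxWDatumPackage

/-!
# Crux `BulkDominatesColdBoxW` (stmt-QuantumFields-19609), line `dlr-chessboard`, skeleton v8: the registered stub
# `stub_kernelCovExpansion` — the one-scale expansion of the deep kernel COVARIANCE, uniformly over crude-good data

`stub_kernelCovExpansion : ∃ θ₂ : ℝ, 0 < θ₂ ∧ ∀ θ : ℝ, 0 < θ → θ ≤ θ₂ → KernelCovExpansion (θ / 20) θ (θ / 5)` with `θ₂ = 1/200`.

## The argument (A-cov of the critic's STUB-PLAN; every input is a tree theorem)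

Fix `0 < θ ≤ 1/200`, `δ = θ/5`, `ε = 6θ`, `A = θ/20`; eventually in `β`, `H = ⌈β^θ⌉`, `T = ⌈β^A⌉` (`8T ≤ H`).  For a crude-good datum `ω`:
1. **datum package** (`exists_datum_package_eventually`): a gauge `g` and a datum `ϑ` charting `W = forestFix H (glueWith E ((ω^g)|_E) 1)` off the
   cold box, of size `Σ_c ϑ_c(e)² ≤ 2·278400²β^{6θ+2δ−1}`, zero on the forest, with the energy clause `Σ_c M_{ϑ_c}(s_c) ≤ 16(2H+3)⁴β^{2δ−1}`;
2. **bridge** (`integral_plaqCostAt(_mul)_boxKernel_eq_trunc_gauge_of_near_centre`, `integral_boxKernel_forestFix_eq`,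
   `measureReal_largeField_boxKernel_eq_of_gauge_trunc`): the kernel means of `c_p`, `c_q`, `c_pc_q` and the large-field probability are the
   same at `ω` and at `W`; **YM rarity** `boxKernel_real_coldGoodSet_compl_le` (`3θ + δ < ε`);
3. **the expansion at `W`** (`abs_kernelCov_sub_gaussian_le_rpow`: T3 ×3, T4, R3-datum, goodTD sandwich, the A-cov core with moments, monomial
   bookkeeping), whose finitely many smallness conditions `C(2H+3)^kβ^a ≤ β^b`, `C(2H+3)^k e^{−β^ε} ≤ β^b` hold eventually (`…EventuallyPow`)
   because `53θ < 1/2`.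
No sorry; no new definition; no named-fact hypothesis; standard axioms.  NOT a claim about the mass gap: a finite-volume weak-coupling statement
about one Wilson box with a small boundary datum.
-/

set_option autoImplicit false

noncomputable section

open MeasureTheory ProbabilityTheory Finset Real Filter
open Literature.Probability.LatticeModels
open Literature.MathematicalPhysics.QuantumLattice
open Literature.MathematicalPhysics.QuantumFieldTheory
open Literature.MathematicalPhysics.QuantumFieldTheory.LatticeMaxwell
open Literature.MathematicalPhysics.QuantumFieldTheory.AxialGauge

namespace Summit.QuantumFields.YangMills.Theorems.WeakCouplingRates

set_option maxHeartbeats 400000 in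
/-- **A-cov for small `θ`**: `KernelCovExpansion (θ/20) θ (θ/5)` for every `0 < θ ≤ 1/200`. -/
theorem kernelCovExpansion_of_le {θ : ℝ} (hθ : 0 < θ) (hθ₂ : θ ≤ 1 / 200) : KernelCovExpansion (θ / 20) θ (θ / 5) := by
  set δ : ℝ := θ / 5 with hδdef
  set A : ℝ := θ / 20 with hAdef
  set ε : ℝ := 6 * θ with hεdef
  have hδ : 0 ≤ δ := by rw [hδdef]; positivity
  have hA0 : 0 ≤ A := by rw [hAdef]; positivity
  have hε : 0 < ε := by rw [hεdef]; positivity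
  have hδε : 3 * θ + δ ≤ ε := by rw [hδdef, hεdef]; linarith
  have hε2 : ε / 2 ≤ 3 * θ + δ := by rw [hδdef, hεdef]; linarith
  have hYM : 3 * θ + δ < ε := by rw [hδdef, hεdef]; linarith
  have hwin9 : 9 * θ + δ < 1 / 2 := by rw [hδdef]; linarith
  -- ## eventual facts
  have f0 : ∀ β : ℝ, (2 : ℝ) ≤ β → (2 : ℝ) ≤ β := fun β h => h
  obtain ⟨b1, f1⟩ := exists_datum_package_eventually hθ hδ hwin9
  obtain ⟨b2, f2⟩ := boxKernel_real_coldGoodSet_compl_le hθ hδ hYM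
  obtain ⟨b3, -, f3⟩ := exists_const_mul_rpow_le_rpow 16 (show A < θ by rw [hAdef]; linarith)
  obtain ⟨b4, -, f4⟩ := exists_const_mul_boxSide_pow_mul_rpow_le (4 * 14400005) 2 (a := ε - 1 / 2) (b := 0) hθ
    (by rw [hεdef]; push_cast; linarith)
  obtain ⟨b5, -, f5⟩ := exists_const_mul_boxSide_pow_mul_rpow_le (4 * 17650000) 4 (a := 3 * θ + δ - 1 / 2) (b := 0) hθ
    (by rw [hδdef]; push_cast; linarith)
  obtain ⟨b6, -, f6⟩ := exists_const_mul_boxSide_pow_mul_rpow_le (3 * (3 / 2 * 2400008 ^ 2)) 4 (a := 6 * θ + 2 * δ - 1)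
    (b := 2 * ε - 1) hθ (by rw [hδdef, hεdef]; push_cast; linarith)
  obtain ⟨b7, -, f7⟩ := exists_const_mul_boxSide_pow_mul_rpow_le (3 * (362 * 17650000 ^ 3)) 12 (a := 9 * θ + 3 * δ - 3 / 2)
    (b := 2 * ε - 1) hθ (by rw [hδdef, hεdef]; push_cast; linarith)
  obtain ⟨b8, -, f8⟩ := exists_const_mul_boxSide_pow_mul_rpow_le (4 * (43440 * 14400005 ^ 3)) 10 (a := 3 * ε - 1 / 2) (b := 0) hθ
    (by rw [hεdef]; push_cast; linarith)
  obtain ⟨b9, -, f9⟩ := exists_const_mul_boxSide_pow_mul_rpow_le (4 * (8 * 14400005 ^ 2)) 8 (a := 2 * ε - 1) (b := 0) hθ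
    (by rw [hεdef]; push_cast; linarith)
  obtain ⟨b10, -, f10⟩ := exists_const_mul_rpow_mul_exp_neg_le 96 2 (-θ) hε
  obtain ⟨b11, -, f11⟩ := exists_const_mul_boxSide_pow_mul_rpow_le (12 * (43440 * 14400005 ^ 3)) 10 (a := 7 * ε - 1 / 2) (b := -θ) hθ
    (by rw [hεdef]; push_cast; linarith)
  obtain ⟨b12, -, f12⟩ := exists_const_mul_boxSide_pow_mul_rpow_le (12 * (8 * 14400005 ^ 2)) 8 (a := 6 * ε - 1) (b := -θ) hθ
    (by rw [hεdef]; push_cast; linarith)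
  obtain ⟨b13, -, f13⟩ := exists_const_mul_boxSide_pow_mul_exp_neg_le 4320 4 hθ.le hε (-θ - 4 * ε)
  obtain ⟨b14, -, f14⟩ := exists_const_mul_boxSide_pow_mul_rpow_le (724 * 14400005 ^ 3) 6 (a := 5 * ε - 1 / 2) (b := -θ) hθ
    (by rw [hεdef]; push_cast; linarith)
  obtain ⟨b15, -, f15⟩ := exists_const_mul_boxSide_pow_mul_rpow_le (724 * 14400005 ^ 3 * (6 * 2400006 ^ 2 + 11)) 10
    (a := 3 * ε + 2 * (3 * θ + δ) - 1 / 2) (b := -θ) hθ (by rw [hδdef, hεdef]; push_cast; linarith)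
  obtain ⟨b16, -, f16⟩ := exists_const_mul_boxSide_pow_mul_exp_neg_le (54 * (6 * 2400006 ^ 2 + 11)) 6 hθ.le hε
    (-θ - (2 * ε + 2 * (3 * θ + δ)))
  obtain ⟨b17, -, f17⟩ := exists_const_mul_boxSide_pow_mul_exp_neg_le (108 * (6 * 2400006 ^ 2 + 11) ^ 2) 10 hθ.le hε
    (-θ - 4 * (3 * θ + δ))
  obtain ⟨b18, -, f18⟩ := exists_const_mul_rpow_le_rpow 8 (show -θ < -(θ / 2) by linarith)
  have E := ((((((((((((((((((Filter.eventually_atTop.2 ⟨(2 : ℝ), f0⟩).and (Filter.eventually_atTop.2 ⟨b1, f1⟩)).and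
    (Filter.eventually_atTop.2 ⟨b2, f2⟩)).and (Filter.eventually_atTop.2 ⟨b3, f3⟩)).and (Filter.eventually_atTop.2 ⟨b4, f4⟩)).and
    (Filter.eventually_atTop.2 ⟨b5, f5⟩)).and (Filter.eventually_atTop.2 ⟨b6, f6⟩)).and (Filter.eventually_atTop.2 ⟨b7, f7⟩)).and
    (Filter.eventually_atTop.2 ⟨b8, f8⟩)).and (Filter.eventually_atTop.2 ⟨b9, f9⟩)).and (Filter.eventually_atTop.2 ⟨b10, f10⟩)).and
    (Filter.eventually_atTop.2 ⟨b11, f11⟩)).and (Filter.eventually_atTop.2 ⟨b12, f12⟩)).and (Filter.eventually_atTop.2 ⟨b13, f13⟩)).and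
    (Filter.eventually_atTop.2 ⟨b14, f14⟩)).and (Filter.eventually_atTop.2 ⟨b15, f15⟩)).and (Filter.eventually_atTop.2 ⟨b16, f16⟩)).and
    (Filter.eventually_atTop.2 ⟨b17, f17⟩)).and (Filter.eventually_atTop.2 ⟨b18, f18⟩)
  obtain ⟨B, hB⟩ := Filter.eventually_atTop.1 E
  unfold KernelCovExpansion
  refine ⟨B, fun β hβ ω hω => ?_⟩
  obtain ⟨⟨⟨⟨⟨⟨⟨⟨⟨⟨⟨⟨⟨⟨⟨⟨⟨⟨hβ2, hpack⟩, hrare⟩, h8T⟩, hm4⟩, hms4⟩, hwin1⟩, hwin2⟩, hw1⟩, hw2⟩, h1⟩, h2a⟩, h2b⟩, h3⟩, h4a⟩, h4b⟩,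
    h5a⟩, h5b⟩, hsum⟩ := hB β hβ
  have hβ1 : (1 : ℝ) ≤ β := by linarith
  have hβ0 : 0 < β := by linarith
  rw [Real.rpow_zero] at hm4 hms4 hw1 hw2
  -- ## the box, the pair, the datum package
  set H : ℕ := ⌈β ^ θ⌉₊ with hHdef
  set T : ℕ := ⌈β ^ A⌉₊ with hTdef
  obtain ⟨hH1r, -⟩ := one_le_ceil_rpow_and_le (A := θ) hβ1 hθ.le
  have hH : 1 ≤ H := by exact_mod_cast hH1r
  have h8T' : 8 * T ≤ H := by
    have hT2 : (T : ℝ) ≤ 2 * β ^ A := natCeil_rpow_le_two_mul hβ1 hA0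
    have hHr : β ^ θ ≤ (H : ℝ) := Nat.le_ceil _
    have h : (8 * T : ℝ) ≤ (H : ℝ) := by linarith
    exact_mod_cast h
  have hT : T ≤ H := le_trans (Nat.le_mul_of_pos_left T (by norm_num)) h8T'
  obtain ⟨g, ϑ, hWchart, hϑ, hforest, s, hE⟩ := hpack ω hω
  set W : LGConfig 4 (Matrix.specialUnitaryGroup (Fin 2) ℂ) := forestFix H (glueWith (boxEdgesAt dirCorner (2 * H + 3))
    (fun e' : ↥(boxEdgesAt dirCorner (2 * H + 3)) => gaugeTransformZd g ω e'.1) (fun _ => 1)) with hWdef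
  -- ## YM rarity at `W` (transported from `ω`)
  have hpY : (boxKernel β H W).real (coldGoodSet β ε H)ᶜ ≤ Real.exp (-(β ^ ε)) := by
    have h := hrare ω hω
    rw [coldGoodSet, compl_compl] at h ⊢
    rw [hWdef, ← measureReal_largeField_boxKernel_eq_of_gauge_trunc β (β ^ (2 * ε - 1)) H ω g]
    exact h
  -- ## the expansion at `W`
  have hmain := abs_kernelCov_sub_gaussian_le_rpow (θ := θ) (δ := δ) (ε := ε) (T := T) hβ1 hH hT hθ hδ hδε hε2 hWchart hϑ hforest hE hpY
    hm4 hms4 hwin1 hwin2 hw1 hw2 h1 h2a h2b h3 h4a h4b h5a h5b hsum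
  -- ## transport of the three kernel integrals from `ω` to `W`
  obtain ⟨hx, hy⟩ := centre_pair_near_centre h8T'
  have h12 : (1 : Fin 4) ≠ 2 := by decide
  have eF : ∫ U, plaqCostAt (fundamentalRep (Fin 2)) (boxCentre H) 1 2 U ∂(boxKernel β H ω) =
      ∫ U, plaqCostAt (fundamentalRep (Fin 2)) (boxCentre H) 1 2 U ∂(boxKernel β H W) :=
    (integral_plaqCostAt_boxKernel_eq_trunc_gauge_of_near_centre β hH ω g hx h12).trans
      (integral_boxKernel_forestFix_eq β H _ (measurable_plaqCostAt _ _ _) (isZdGaugeInvariant_plaqCostAt _ _ _ _)).symm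
  have eG : ∫ U, plaqCostAt (fundamentalRep (Fin 2)) (boxCentre H + Pi.single 0 (T : ℤ)) 1 2 U ∂(boxKernel β H ω) =
      ∫ U, plaqCostAt (fundamentalRep (Fin 2)) (boxCentre H + Pi.single 0 (T : ℤ)) 1 2 U ∂(boxKernel β H W) :=
    (integral_plaqCostAt_boxKernel_eq_trunc_gauge_of_near_centre β hH ω g hy h12).trans
      (integral_boxKernel_forestFix_eq β H _ (measurable_plaqCostAt _ _ _) (isZdGaugeInvariant_plaqCostAt _ _ _ _)).symm
  have eFG : ∫ U, plaqCostAt (fundamentalRep (Fin 2)) (boxCentre H) 1 2 U *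
        plaqCostAt (fundamentalRep (Fin 2)) (boxCentre H + Pi.single 0 (T : ℤ)) 1 2 U ∂(boxKernel β H ω) =
      ∫ U, plaqCostAt (fundamentalRep (Fin 2)) (boxCentre H) 1 2 U *
        plaqCostAt (fundamentalRep (Fin 2)) (boxCentre H + Pi.single 0 (T : ℤ)) 1 2 U ∂(boxKernel β H W) :=
    (integral_plaqCostAt_mul_boxKernel_eq_trunc_gauge_of_near_centre β hH ω g hx hy h12 h12).trans
      (integral_boxKernel_forestFix_eq β H _ ((measurable_plaqCostAt _ _ _).mul (measurable_plaqCostAt _ _ _))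
        (isZdGaugeInvariant_plaqCostAt_mul _ _ _ _ _ _ _)).symm
  refine ⟨ϑ, s, hE, ?_⟩
  rw [eF, eG, eFG]
  exact hmain

/-- **Registered stub `stub_kernelCovExpansion` of crux `BulkDominatesColdBoxW`** (line `dlr-chessboard`, skeleton v8 `467507eaefe7a2cc`), by
name and signature: there is `θ₂ > 0` (`= 1/200`) such that `KernelCovExpansion (θ/20) θ (θ/5)` holds for all `0 < θ ≤ θ₂` — uniformly over
crude-good data, the deep two-plaquette kernel covariance is its Dirichlet–Gaussian value `(3/2)C_D² + 2β(Σ_c F̄_c(p)F̄_c(q))C_D` up to `β^{−θ/2}`. -/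
theorem stub_kernelCovExpansion : ∃ θ₂ : ℝ, 0 < θ₂ ∧ ∀ θ : ℝ, 0 < θ → θ ≤ θ₂ → KernelCovExpansion (θ / 20) θ (θ / 5) :=
  ⟨1 / 200, by norm_num, fun _ hθ hθ₂ => kernelCovExpansion_of_le hθ hθ₂⟩

end Summit.QuantumFields.YangMills.Theorems.WeakCouplingRates

end
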